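import Summits.ResolutionOfSingularities.ResolutionOfSingularities.Theorems.FrobeniusLadderFInjectiveMacaulayficationHFedderCertificates
import Summits.ResolutionOfSingularities.ResolutionOfSingularities.Theorems.FrobeniusLadderFInjectiveMacaulayficationClauseOfPderivNotMem
import Mathlib.Algebra.MvPolynomial.Equiv
import Mathlib.Algebra.MvPolynomial.PDeriv
import Mathlib.Algebra.CharP.Lemmas
import Mathlib.Logic.Equiv.Fin.Basic
import HarnessLib

/-!
# The punctured `(3,3,3,2)`-cone of the frontier threefold S1 is clause-good in characteristic `2` (`S1FaceConeClause`)
# (crux `FInjectiveMacaulayfication`, line `graded-engine` §17 filtered engine G4♮/G5♮, first FILTERED calibration)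

Support file for crux stmt-ResolutionOfSingularities-15315 (`FrobeniusLadder.FInjectiveMacaulayfication`), chain w45a,
seat res-L1-w45a-stub-3. [OURS · L1 W4.5a, CRUX-PLAN v4 §4/§5; idea-1 r2 card `face-rule`, typed `S1FaceConeClause`] — NOT a
statement of the manuscript; AI-written, weaker than expert review.

S1 is tri-1's frontier threefold `X₀²X₁ + X₁²X₂ + X₂²X₀ + X₀X₃³ + X₁X₂X₃²` in characteristic `2` (stmt-17936); its
`(3,3,3,2)`-initial form is `F₉ = X₀²X₁ + X₁²X₂ + X₂²X₀ + X₀X₃³` (the term `X₁X₂X₃²` has weight `10`). The filtered engine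
G5♮ (`FilteredEngine.filteredConeFiModel_of_filteredChartClause`, CRUX-PLAN v4 §4) consumes the CONE hypothesis `hoff₀`: the
Cohen–Macaulay + Frobenius-closed clause for `k[X]/(F₉)` at every maximal ideal missing some variable. This file proves it
(`s1FaceConeClause_char2`), correcting tri-1 §6 F2 as idea-1 predicted: in characteristic `2`,
`∂₁F₉ = X₀²`, `∂₂F₉ = X₁²`, `∂₀F₉ = X₂² + X₃³`, so `Sing V(F₉) = Γ = {X₀ = X₁ = 0, X₂² = X₃³}` (a cuspidal curve) and the
Jacobian discharger (`ClauseOfPderivNotMem`) covers every closed point off `Γ`; along `Γ ∖ 0` — closed points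
`P ⊋ (X₀, X₁, X₂² + X₃³)` over an ARBITRARY field of characteristic `2` — Fedder's test `F₉ ∉ P^[2]` is run through the
slicing `k[X] ≃ B[Y₀,Y₁]`, `B = k[X₂,X₃]` (`CoordinateSlicing`): the `Y₀`-coefficient of `F₉` is `φ = X₂² + X₃³`, so `F₉ ∈ P^[2]`
forces `φ ∈ 𝔭^[2]` (`𝔭 = P ∩ B ∋ φ`); but `X₃ ∉ 𝔭` (else `P = 𝔪`), `∂φ/∂X₃ = 3X₃² ∉ 𝔭`, the cusp `B_𝔭/(φ)` is REGULAR off its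
vertex, hence satisfies the clause, hence — Fedder read backwards (`FedderAtMaximalIdeal.fedder_criterion_maximalIdeal`) —
`φ ∉ 𝔭^[2]`: contradiction (transversal type `A₁ × line`, not a cusp). idea-1's machine evidence `faces/S1.out` (0 non-F-pure
singular points over `GF(2^e)`, `e ≤ 4`) is hereby kernel-checked over every field of characteristic `2`.

Contents: `exists_baseSlicing23` (the slicing), `pderiv_*_F9`, `two_eq_zero_char2`, `clause_cuspCurve_char2` (the Fedder
certificate along `Γ ∖ 0`), `s1FaceConeClause_char2` (the `hoff₀` of G4♮/G5♮ for S1). All proofs are glue on Mathlib and landed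
files; no definitions, no named facts. References: [Fedder1983] R. Fedder, *F-purity and rational singularity*, Trans. AMS 278
(1983), Prop. 1.7, Thm. 1.12 (through the imported criterion). [folklore]
-/

-- single-problem summit: the doubled namespace component is forced
set_option linter.dupNamespace false

noncomputable section

namespace Summit.ResolutionOfSingularities.ResolutionOfSingularities.Theorems.FInjectiveMacaulayfication.S1FaceConeClause

open MvPolynomial IsLocalRing
open Summit.ResolutionOfSingularities.ResolutionOfSingularities.Theorems.FInjectiveMacaulayfication

/-! ## The slicing with base `k[X₂,X₃]` and slices `X₀, X₁` -/

/-- **Slicing** `k[X₀,…,X₃] ≃ B[Y₀,Y₁]`, `B = k[X₂,X₃]` (renamed `X 0, X 1`): `X₀ ↦ Y₀`, `X₁ ↦ Y₁`, `X₂ ↦ C X₀`, `X₃ ↦ C X₁`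
(`renameEquiv` along `finSumFinEquiv.symm : Fin 4 ≃ Fin 2 ⊕ Fin 2` followed by `sumAlgEquiv`). [folklore] -/
theorem exists_baseSlicing23 (k : Type) [Field k] :
    ∃ Ψ : MvPolynomial (Fin 4) k ≃+* MvPolynomial (Fin 2) (MvPolynomial (Fin 2) k),
      Ψ (X 0) = X 0 ∧ Ψ (X 1) = X 1 ∧ Ψ (X 2) = C (X 0) ∧ Ψ (X 3) = C (X 1) := by
  have e0 : (@finSumFinEquiv 2 2).symm 0 = Sum.inl 0 := by decide
  have e1 : (@finSumFinEquiv 2 2).symm 1 = Sum.inl 1 := by decide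
  have e2 : (@finSumFinEquiv 2 2).symm 2 = Sum.inr 0 := by decide
  have e3 : (@finSumFinEquiv 2 2).symm 3 = Sum.inr 1 := by decide
  refine ⟨((renameEquiv k (@finSumFinEquiv 2 2).symm).trans (sumAlgEquiv k (Fin 2) (Fin 2))).toRingEquiv,
    ?_, ?_, ?_, ?_⟩
  · show sumAlgEquiv k (Fin 2) (Fin 2) (rename _ (X 0)) = _
    rw [rename_X, e0]
    exact sumAlgEquiv_X_inl _ _ _ _
  · show sumAlgEquiv k (Fin 2) (Fin 2) (rename _ (X 1)) = _
    rw [rename_X, e1]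
    exact sumAlgEquiv_X_inl _ _ _ _
  · show sumAlgEquiv k (Fin 2) (Fin 2) (rename _ (X 2)) = _
    rw [rename_X, e2]
    exact sumAlgEquiv_X_inr _ _ _ _
  · show sumAlgEquiv k (Fin 2) (Fin 2) (rename _ (X 3)) = _
    rw [rename_X, e3]
    exact sumAlgEquiv_X_inr _ _ _ _

/-! ## Partial derivatives of `F₉` and characteristic `2` -/

/-- `∂₀ F₉ = 2X₀X₁ + X₂² + X₃³`. [folklore] -/
theorem pderiv_zero_F9 {A : Type*} [CommRing A] :
    pderiv 0 (X 0 ^ 2 * X 1 + X 1 ^ 2 * X 2 + X 2 ^ 2 * X 0 + X 0 * X 3 ^ 3 : MvPolynomial (Fin 4) A) =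
      2 * (X 0 * X 1) + (X 2 ^ 2 + X 3 ^ 3) := by
  simp only [map_add, pderiv_mul, pderiv_pow, pderiv_X_self,
    pderiv_X_of_ne (show (1 : Fin 4) ≠ 0 by decide), pderiv_X_of_ne (show (2 : Fin 4) ≠ 0 by decide),
    pderiv_X_of_ne (show (3 : Fin 4) ≠ 0 by decide)]
  norm_num
  ring

/-- `∂₁ F₉ = X₀² + 2X₁X₂`. [folklore] -/
theorem pderiv_one_F9 {A : Type*} [CommRing A] :
    pderiv 1 (X 0 ^ 2 * X 1 + X 1 ^ 2 * X 2 + X 2 ^ 2 * X 0 + X 0 * X 3 ^ 3 : MvPolynomial (Fin 4) A) =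
      X 0 ^ 2 + 2 * (X 1 * X 2) := by
  simp only [map_add, pderiv_mul, pderiv_pow, pderiv_X_self,
    pderiv_X_of_ne (show (0 : Fin 4) ≠ 1 by decide), pderiv_X_of_ne (show (2 : Fin 4) ≠ 1 by decide),
    pderiv_X_of_ne (show (3 : Fin 4) ≠ 1 by decide)]
  norm_num
  ring

/-- `∂₂ F₉ = X₁² + 2X₂X₀`. [folklore] -/
theorem pderiv_two_F9 {A : Type*} [CommRing A] :
    pderiv 2 (X 0 ^ 2 * X 1 + X 1 ^ 2 * X 2 + X 2 ^ 2 * X 0 + X 0 * X 3 ^ 3 : MvPolynomial (Fin 4) A) =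
      X 1 ^ 2 + 2 * (X 2 * X 0) := by
  simp only [map_add, pderiv_mul, pderiv_pow, pderiv_X_self,
    pderiv_X_of_ne (show (0 : Fin 4) ≠ 2 by decide), pderiv_X_of_ne (show (1 : Fin 4) ≠ 2 by decide),
    pderiv_X_of_ne (show (3 : Fin 4) ≠ 2 by decide)]
  norm_num
  ring

/-- `2 = 0` in a polynomial ring over a field of characteristic `2`. [folklore] -/
theorem two_eq_zero_char2 (k : Type) [Field k] [CharP k 2] {σ : Type*} : (2 : MvPolynomial σ k) = 0 := by
  have h2 : (2 : k) = 0 := by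
    have h := CharP.cast_eq_zero k 2
    simpa using h
  rw [← map_ofNat (C : k →+* MvPolynomial σ k) 2, h2, map_zero]

/-! ## The Fedder certificate along the cuspidal curve `Γ ∖ 0` -/

/-- **FEDDER CERTIFICATE ALONG `Γ = {X₀ = X₁ = 0, X₂² = X₃³}` OFF THE ORIGIN (`p = 2`)**: at every maximal ideal `Q` of
`k[X]/(F₉)` containing `x̄₀, x̄₁` and `x̄₂² + x̄₃³` but not all `x̄ⱼ`, the local ring satisfies the Cohen–Macaulay +
Frobenius-closed clause. [cite: Fedder1983, Thm. 1.12] -/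
theorem clause_cuspCurve_char2 (k : Type) [Field k] [CharP k 2] (F : MvPolynomial (Fin 4) k)
    (hF : F = X 0 ^ 2 * X 1 + X 1 ^ 2 * X 2 + X 2 ^ 2 * X 0 + X 0 * X 3 ^ 3)
    (Q : Ideal (MvPolynomial (Fin 4) k ⧸ Ideal.span {F})) [Q.IsMaximal]
    (hQ0 : Ideal.Quotient.mk (Ideal.span {F}) (X 0) ∈ Q) (hQ1 : Ideal.Quotient.mk (Ideal.span {F}) (X 1) ∈ Q)
    (hQφ : Ideal.Quotient.mk (Ideal.span {F}) (X 2 ^ 2 + X 3 ^ 3) ∈ Q)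
    (hj : ∃ j : Fin 4, Ideal.Quotient.mk (Ideal.span {F}) (X j) ∉ Q) :
    ∀ d : ℕ, ringKrullDim (Localization.AtPrime Q) = d → ∀ s : Fin d → Localization.AtPrime Q,
      (Ideal.span (Set.range s)).radical.IsMaximal →
        RingTheory.Sequence.IsWeaklyRegular (Localization.AtPrime Q) (List.ofFn s) ∧
        ∀ y : Localization.AtPrime Q, (∃ e : ℕ, y ^ 2 ^ e ∈ Ideal.span
          ((fun z : Localization.AtPrime Q => z ^ 2 ^ e) ''
            (Ideal.span (Set.range s) : Set (Localization.AtPrime Q)))) → y ∈ Ideal.span (Set.range s) := by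
  haveI : Fact (Nat.Prime 2) := ⟨Nat.prime_two⟩
  haveI hPmax : (Q.comap (Ideal.Quotient.mk (Ideal.span {F}))).IsMaximal :=
    Ideal.comap_isMaximal_of_surjective _ Ideal.Quotient.mk_surjective
  obtain ⟨Ψ, hΨ0, hΨ1, hΨ2, hΨ3⟩ := exists_baseSlicing23 k
  have hy0 : Ψ.symm (X 0) = X 0 := Ψ.symm_apply_eq.mpr hΨ0.symm
  have hy1 : Ψ.symm (X 1) = X 1 := Ψ.symm_apply_eq.mpr hΨ1.symm
  have hb0 : Ψ.symm (C (X 0)) = X 2 := Ψ.symm_apply_eq.mpr hΨ2.symm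
  have hb1 : Ψ.symm (C (X 1)) = X 3 := Ψ.symm_apply_eq.mpr hΨ3.symm
  have hy : ∀ s : Fin 2, Ψ.symm (X s) ∈ Q.comap (Ideal.Quotient.mk (Ideal.span {F})) := by
    intro s
    fin_cases s
    · exact hy0 ▸ Ideal.mem_comap.mpr hQ0
    · exact hy1 ▸ Ideal.mem_comap.mpr hQ1
  -- the base point `𝔭 = P ∩ k[X₂,X₃]` and its generators
  haveI h𝔭 : ((Q.comap (Ideal.Quotient.mk (Ideal.span {F}))).comap (Ψ.symm.toRingHom.comp C)).IsMaximal :=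
    CoordinateSlicing.comap_slice_isMaximal Ψ _ hy
  obtain ⟨m, a, ha⟩ := Submodule.fg_iff_exists_fin_generating_family.mp
    (IsNoetherian.noetherian ((Q.comap (Ideal.Quotient.mk (Ideal.span {F}))).comap (Ψ.symm.toRingHom.comp C)))
  have hPA := CoordinateSlicing.eq_span_sliceFamily Ψ _ hy a ha
  have hF0 : F ≠ 0 := by
    intro h0
    have h1 := congrArg (MvPolynomial.eval ![(1 : k), 1, 0, 0]) h0
    rw [hF] at h1
    simp at h1
  refine FedderAtMaximalIdeal.stub_fedderAtMaximalIdeal 2 k 4 (2 + m) _ F Q hPA hF0 ?_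
  -- Fedder's test: `F ∉ (A_i²)`
  intro hmem
  have hd : ∀ s : Fin 2, (Finsupp.single (0 : Fin 2) 1 : Fin 2 →₀ ℕ) s < 2 := by
    intro s
    fin_cases s <;> simp
  have hext := CoordinateSlicing.coeff_mem_span_of_mem_span Ψ (Finsupp.single (0 : Fin 2) 1) 2 hd a hmem
  -- the extracted coefficient is `φ = X₂² + X₃³`
  have hΨF : Ψ F = X 0 ^ 2 * X 1 + X 1 ^ 2 * C (X 0) + C (X 0) ^ 2 * X 0 + X 0 * C (X 1) ^ 3 := by
    rw [hF]
    simp only [map_add, map_mul, map_pow, hΨ0, hΨ1, hΨ2, hΨ3]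
  have hval : coeff (Finsupp.single (0 : Fin 2) 1) (Ψ (F ^ (2 - 1))) = X 0 ^ 2 + X 1 ^ 3 := by
    rw [show (2 - 1 : ℕ) = 1 from rfl, pow_one, hΨF]
    have e1 : (X 0 ^ 2 * X 1 + X 1 ^ 2 * C (X 0) + C (X 0) ^ 2 * X 0 + X 0 * C (X 1) ^ 3 :
        MvPolynomial (Fin 2) (MvPolynomial (Fin 2) k)) =
        C (X 0 ^ 2 + X 1 ^ 3) * monomial (Finsupp.single (0 : Fin 2) 1) 1 + X 0 ^ 2 * X 1 + X 1 ^ 2 * C (X 0) := by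
      rw [show (monomial (Finsupp.single (0 : Fin 2) 1) 1 : MvPolynomial (Fin 2) (MvPolynomial (Fin 2) k)) = X 0
        from rfl]
      simp only [map_add, map_pow]
      ring
    rw [e1, coeff_add, coeff_add, coeff_C_mul, coeff_monomial, if_pos rfl, mul_one,
      coeff_X_pow_mul_eq_zero' 0, coeff_X_pow_mul_eq_zero' 1, add_zero, add_zero]
    · exact hd 1
    · exact hd 0
  rw [hval] at hext
  -- `φ ∈ 𝔭` (the point lies on `Γ`) and `X₃ ∉ 𝔭` (the point is not the origin)
  have hφ : (X 0 ^ 2 + X 1 ^ 3 : MvPolynomial (Fin 2) k) ∈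
      (Q.comap (Ideal.Quotient.mk (Ideal.span {F}))).comap (Ψ.symm.toRingHom.comp C) := by
    rw [Ideal.mem_comap, RingHom.comp_apply, RingEquiv.toRingHom_eq_coe, RingEquiv.coe_toRingHom, map_add, map_pow,
      map_pow, map_add, map_pow, map_pow, hb0, hb1]
    exact Ideal.mem_comap.mpr hQφ
  have hX1 : (X 1 : MvPolynomial (Fin 2) k) ∉
      (Q.comap (Ideal.Quotient.mk (Ideal.span {F}))).comap (Ψ.symm.toRingHom.comp C) := by
    intro hX1
    have hX3 : (X 3 : MvPolynomial (Fin 4) k) ∈ Q.comap (Ideal.Quotient.mk (Ideal.span {F})) := by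
      have := Ideal.mem_comap.mp hX1
      rwa [RingHom.comp_apply, RingEquiv.toRingHom_eq_coe, RingEquiv.coe_toRingHom, hb1] at this
    have hX2 : (X 2 : MvPolynomial (Fin 4) k) ∈ Q.comap (Ideal.Quotient.mk (Ideal.span {F})) := by
      refine hPmax.isPrime.mem_of_pow_mem 2 ?_
      have e : (X 2 ^ 2 : MvPolynomial (Fin 4) k) = (X 2 ^ 2 + X 3 ^ 3) - X 3 ^ 2 * X 3 := by ring
      rw [e]
      exact Ideal.sub_mem _ (Ideal.mem_comap.mpr hQφ) (Ideal.mul_mem_left _ _ hX3)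
    obtain ⟨j, hj⟩ := hj
    apply hj
    fin_cases j
    · exact hQ0
    · exact hQ1
    · exact Ideal.mem_comap.mp hX2
    · exact Ideal.mem_comap.mp hX3
  -- the cusp `φ = X₂² + X₃³` is regular at `𝔭` (`∂φ/∂X₃ = 3X₃²`, `3` a unit, `X₃ ∉ 𝔭`)
  have hd1 : pderiv 1 (X 0 ^ 2 + X 1 ^ 3 : MvPolynomial (Fin 2) k) = 3 * X 1 ^ 2 := by
    simp only [map_add, pderiv_pow, pderiv_X_self, pderiv_X_of_ne (show (0 : Fin 2) ≠ 1 by decide)]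
    norm_num
  have hu3 : IsUnit (3 : MvPolynomial (Fin 2) k) := by
    have h3 : (3 : k) ≠ 0 := by
      intro h
      have h' : ((3 : ℕ) : k) = 0 := by exact_mod_cast h
      rw [CharP.cast_eq_zero_iff k 2 3] at h'
      omega
    have hu := (isUnit_iff_ne_zero.mpr h3).map (C : k →+* MvPolynomial (Fin 2) k)
    rwa [map_ofNat] at hu
  have hdn : pderiv 1 (X 0 ^ 2 + X 1 ^ 3 : MvPolynomial (Fin 2) k) ∉
      (Q.comap (Ideal.Quotient.mk (Ideal.span {F}))).comap (Ψ.symm.toRingHom.comp C) := by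
    rw [hd1]
    intro h3
    exact hX1 (h𝔭.isPrime.mem_of_pow_mem 2 ((Ideal.unit_mul_mem_iff_mem _ hu3).mp h3))
  have hφ0 : (X 0 ^ 2 + X 1 ^ 3 : MvPolynomial (Fin 2) k) ≠ 0 := by
    intro h0
    have h1 := congrArg (MvPolynomial.eval ![(1 : k), 0]) h0
    simp at h1
  haveI hreg := HypersurfaceRegular.isRegularLocalRing_localization_quotient_of_pderiv_not_mem k 2
    (X 0 ^ 2 + X 1 ^ 3) 1 ((Q.comap (Ideal.Quotient.mk (Ideal.span {F}))).comap (Ψ.symm.toRingHom.comp C)) hφ hdn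
  haveI : CharP (Localization.AtPrime ((Q.comap (Ideal.Quotient.mk (Ideal.span {F}))).comap
      (Ψ.symm.toRingHom.comp C)) ⧸ Ideal.span {algebraMap (MvPolynomial (Fin 2) k)
        (Localization.AtPrime ((Q.comap (Ideal.Quotient.mk (Ideal.span {F}))).comap (Ψ.symm.toRingHom.comp C)))
          (X 0 ^ 2 + X 1 ^ 3)}) 2 :=
    charP_of_injective_ringHom (((Ideal.Quotient.mk _).comp ((algebraMap (MvPolynomial (Fin 2) k) _).comp
      (algebraMap k (MvPolynomial (Fin 2) k)))).injective) 2
  have hclause := (FiClauseOfRegular.stub_fiClauseOfRegular 2 (Localization.AtPrime ((Q.comap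
    (Ideal.Quotient.mk (Ideal.span {F}))).comap (Ψ.symm.toRingHom.comp C)) ⧸ Ideal.span
      {algebraMap (MvPolynomial (Fin 2) k) (Localization.AtPrime ((Q.comap (Ideal.Quotient.mk
        (Ideal.span {F}))).comap (Ψ.symm.toRingHom.comp C))) (X 0 ^ 2 + X 1 ^ 3)})).2
  have hnot := (FedderAtMaximalIdeal.fedder_criterion_maximalIdeal k 2 m 2
    ((Q.comap (Ideal.Quotient.mk (Ideal.span {F}))).comap (Ψ.symm.toRingHom.comp C)) a ha.symm
    (X 0 ^ 2 + X 1 ^ 3) hφ hφ0).mp hclause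
  refine hnot ?_
  rw [show (2 - 1 : ℕ) = 1 from rfl, pow_one]
  exact hext
where
  /-- local restatement of `HFedderCertificates.coeff_X_pow_mul_eq_zero` with the exponent vector fixed. -/
  coeff_X_pow_mul_eq_zero' (s : Fin 2) {G : MvPolynomial (Fin 2) (MvPolynomial (Fin 2) k)}
      (h : (Finsupp.single (0 : Fin 2) 1 : Fin 2 →₀ ℕ) s < 2) :
      coeff (Finsupp.single (0 : Fin 2) 1) (X s ^ 2 * G) = 0 :=
    HFedderCertificates.coeff_X_pow_mul_eq_zero _ s 2 h G

/-! ## The cone clause `hoff₀` for S1 -/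

/-- **`S1FaceConeClause` — THE PUNCTURED `(3,3,3,2)`-CONE OF S1 IS CLAUSE-GOOD IN CHARACTERISTIC `2`** (the cone hypothesis
`hoff₀` of the filtered engine G4♮/G5♮ for the frontier threefold S1; idea-1 r2 `face-rule`, typed `S1FaceConeClause`, in the
engines' maximal-ideal form): for `F₉ = X₀²X₁ + X₁²X₂ + X₂²X₀ + X₀X₃³` over any field of characteristic `2`, at every maximal
ideal `Q` of `k[X]/(F₉)` missing some `x̄ⱼ` the local ring satisfies the Cohen–Macaulay + Frobenius-closed clause — Jacobian
off `Γ = {X₀ = X₁ = 0, X₂² = X₃³}` (`∂₁F₉ = X₀²`, `∂₂F₉ = X₁²`, `∂₀F₉ = X₂² + X₃³` in characteristic `2`), Fedder along `Γ ∖ 0`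
(`clause_cuspCurve_char2`). [cite: Fedder1983, Thm. 1.12] -/
theorem s1FaceConeClause_char2 (k : Type) [Field k] [CharP k 2] (F : MvPolynomial (Fin 4) k)
    (hF : F = MvPolynomial.X 0 ^ 2 * MvPolynomial.X 1 + MvPolynomial.X 1 ^ 2 * MvPolynomial.X 2 +
      MvPolynomial.X 2 ^ 2 * MvPolynomial.X 0 + MvPolynomial.X 0 * MvPolynomial.X 3 ^ 3) :
    ∀ (Q : Ideal (MvPolynomial (Fin 4) k ⧸ Ideal.span {F})) [Q.IsMaximal],
      (∃ j : Fin 4, Ideal.Quotient.mk (Ideal.span {F}) (MvPolynomial.X j) ∉ Q) →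
      ∀ d : ℕ, ringKrullDim (Localization.AtPrime Q) = d → ∀ s : Fin d → Localization.AtPrime Q,
        (Ideal.span (Set.range s)).radical.IsMaximal →
          RingTheory.Sequence.IsWeaklyRegular (Localization.AtPrime Q) (List.ofFn s) ∧
          ∀ y : Localization.AtPrime Q, (∃ e : ℕ, y ^ 2 ^ e ∈ Ideal.span
            ((fun z : Localization.AtPrime Q => z ^ 2 ^ e) ''
              (Ideal.span (Set.range s) : Set (Localization.AtPrime Q)))) → y ∈ Ideal.span (Set.range s) := by
  haveI : Fact (Nat.Prime 2) := ⟨Nat.prime_two⟩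
  intro Q _ hj d hd s hs
  haveI hPmax : (Q.comap (Ideal.Quotient.mk (Ideal.span {F}))).IsMaximal :=
    Ideal.comap_isMaximal_of_surjective _ Ideal.Quotient.mk_surjective
  have hP := hPmax.isPrime
  have h2 : (2 : MvPolynomial (Fin 4) k) = 0 := two_eq_zero_char2 k
  have hd0 : pderiv 0 F = X 2 ^ 2 + X 3 ^ 3 := by rw [hF, pderiv_zero_F9, h2, zero_mul, zero_add]
  have hd1 : pderiv 1 F = X 0 ^ 2 := by rw [hF, pderiv_one_F9, h2, zero_mul, add_zero]
  have hd2 : pderiv 2 F = X 1 ^ 2 := by rw [hF, pderiv_two_F9, h2, zero_mul, add_zero]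
  by_cases hX0 : (X 0 : MvPolynomial (Fin 4) k) ∈ Q.comap (Ideal.Quotient.mk (Ideal.span {F})); swap
  · -- `X₀ ∉ P`: `∂₁F₉ = X₀² ∉ P`
    refine ClauseOfPderivNotMem.stub_clauseOfPderivNotMem 2 k 4 F Q 1 ?_ d hd s hs
    rw [hd1]
    exact fun h => hX0 (hP.mem_of_pow_mem 2 h)
  by_cases hX1 : (X 1 : MvPolynomial (Fin 4) k) ∈ Q.comap (Ideal.Quotient.mk (Ideal.span {F})); swap
  · -- `X₁ ∉ P`: `∂₂F₉ = X₁² ∉ P`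
    refine ClauseOfPderivNotMem.stub_clauseOfPderivNotMem 2 k 4 F Q 2 ?_ d hd s hs
    rw [hd2]
    exact fun h => hX1 (hP.mem_of_pow_mem 2 h)
  by_cases hφ : (X 2 ^ 2 + X 3 ^ 3 : MvPolynomial (Fin 4) k) ∈ Q.comap (Ideal.Quotient.mk (Ideal.span {F})); swap
  · -- off `Γ`: `∂₀F₉ = X₂² + X₃³ ∉ P`
    refine ClauseOfPderivNotMem.stub_clauseOfPderivNotMem 2 k 4 F Q 0 ?_ d hd s hs
    rw [hd0]
    exact hφ
  · -- on `Γ ∖ 0`: Fedder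
    exact clause_cuspCurve_char2 k F hF Q (Ideal.mem_comap.mp hX0) (Ideal.mem_comap.mp hX1)
      (Ideal.mem_comap.mp hφ) hj d hd s hs

end Summit.ResolutionOfSingularities.ResolutionOfSingularities.Theorems.FInjectiveMacaulayfication.S1FaceConeClause

end
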